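import Mathlib.Analysis.Fourier.FourierTransformDeriv
import Mathlib.Analysis.Distribution.SchwartzSpace.Fourier
import Literature.Analysis.Fourier.LpMultiplierLimit
import HarnessLib

/-!
# Fourier multiplier operators with bounded symbols: differentiation commutes with `M(D)`

For a bounded, (entrywise) measurable matrix symbol `M : V → Matrix κ ι ℂ` and a Schwartz
(in particular a `C_c^∞`) test function `φ`, the function `M(D)φ = 𝓕⁻¹(M · 𝓕φ)`
(`multiplierOp`, `Literature/Analysis/Fourier/LpMultiplier.lean`) is differentiable and
`∂ᵥ(M(D)φ) = M(D)(∂ᵥφ)`: translation-invariant operators commute with derivatives. Proof: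
`M · 𝓕φ` is integrable with all polynomial moments (bounded times Schwartz), so the inverse
Fourier integral may be differentiated under the integral sign
(`Real.hasFDerivAt_fourier`), producing the factor `2πi⟨ξ, v⟩`, which is also the factor by
which `𝓕(∂ᵥφ)` differs from `𝓕φ` (`SchwartzMap.fourier_lineDerivOp_eq`).

Also (using the sup-norm bound `‖M(ξ)w‖ ≤ |ι| C₀ ‖w‖` of `LpMultiplierLimit.lean`): measurability and
integrability (with moments) of `M · 𝓕φ`. These are the pointwise facts behind the `L¹`- and
`L²`-gradient bounds of [Rauch1986, Proof of Theorem p. 483, (5)] ("look at the gradient of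
the `α`th component of `v` to find that `‖D_l M^{αβ}(D)χ‖_{L¹} ≤ c‖∇χ‖_{L¹}`").

## References

* [Rauch1986] J. Rauch, Comm. Math. Phys. 106 (1986) 481–484, p. 483.
* [Grafakos2014] L. Grafakos, *Classical Fourier Analysis*, 3rd ed. (2014), §2.5.5 (operators
  `T_m`, Def. 2.5.11).
-/

noncomputable section

open MeasureTheory FourierTransform
open scoped SchwartzMap ENNReal NNReal ContDiff RealInnerProductSpace
open LineDeriv

namespace Literature.Analysis.Fourier

variable {ι κ : Type*} [Fintype ι] [Fintype κ]

/-! ### Entrywise bounded, measurable symbols -/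

omit [Fintype κ] in
/-- `ξ ↦ M(ξ) g(ξ)` is measurable for entrywise measurable `M` and measurable `g`. [folklore] -/
theorem measurable_mulVec {X : Type*} [MeasurableSpace X] {M : X → Matrix κ ι ℂ}
    (hM : ∀ a b, Measurable fun ξ => M ξ a b)
    {g : X → ι → ℂ} (hg : Measurable g) : Measurable fun ξ => (M ξ).mulVec (g ξ) := by
  refine measurable_pi_iff.2 fun a => ?_
  have : (fun ξ => (M ξ).mulVec (g ξ) a) = fun ξ => ∑ b, M ξ a b * g ξ b := rfl
  rw [this]
  exact Finset.measurable_sum _ fun b _ => (hM a b).mul ((measurable_pi_apply b).comp hg)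

/-- Pointwise bound `‖M(ξ)g(ξ)‖ ≤ |ι| C₀ ‖g(ξ)‖` for an entrywise bounded symbol. [folklore] -/
theorem norm_mulVec_apply_le {X : Type*} {M : X → Matrix κ ι ℂ} {C₀ : ℝ} (hC0 : 0 ≤ C₀)
    (hC : ∀ ξ a b, ‖M ξ a b‖ ≤ C₀) (g : X → ι → ℂ) (ξ : X) :
    ‖(M ξ).mulVec (g ξ)‖ ≤ Fintype.card ι * C₀ * ‖g ξ‖ :=
  norm_mulVec_le_of_entry_le hC0 (hC ξ) (g ξ)

variable {V : Type*} [NormedAddCommGroup V] [InnerProductSpace ℝ V] [FiniteDimensional ℝ V]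
  [MeasurableSpace V] [BorelSpace V]

/-- For Schwartz `g`, `ξ ↦ ‖ξ‖ⁿ M(ξ)g(ξ)` is integrable (bounded times Schwartz). [folklore] -/
theorem integrable_pow_mul_norm_mulVec {M : V → Matrix κ ι ℂ}
    (hM : ∀ a b, Measurable fun ξ => M ξ a b) {C₀ : ℝ} (hC0 : 0 ≤ C₀)
    (hC : ∀ ξ a b, ‖M ξ a b‖ ≤ C₀) (g : 𝓢(V, ι → ℂ)) (n : ℕ) :
    Integrable (fun ξ => ‖ξ‖ ^ n * ‖(M ξ).mulVec (g ξ)‖) := by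
  have hmeas : AEStronglyMeasurable (fun ξ => ‖ξ‖ ^ n * ‖(M ξ).mulVec (g ξ)‖) volume :=
    ((continuous_norm.pow n).measurable.mul
      (measurable_mulVec hM g.continuous.measurable).norm).aestronglyMeasurable
  refine ((g.integrable_pow_mul volume n).const_mul (Fintype.card ι * C₀)).mono' hmeas
    (Filter.Eventually.of_forall fun ξ => ?_)
  rw [Real.norm_eq_abs, abs_of_nonneg (by positivity)]
  calc ‖ξ‖ ^ n * ‖(M ξ).mulVec (g ξ)‖ ≤ ‖ξ‖ ^ n * (Fintype.card ι * C₀ * ‖g ξ‖) :=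
        mul_le_mul_of_nonneg_left (norm_mulVec_apply_le hC0 hC (⇑g) ξ) (by positivity)
    _ = Fintype.card ι * C₀ * (‖ξ‖ ^ n * ‖g ξ‖) := by ring

/-- For Schwartz `g`, `M · g` is integrable. [folklore] -/
theorem integrable_mulVec {M : V → Matrix κ ι ℂ} (hM : ∀ a b, Measurable fun ξ => M ξ a b)
    {C₀ : ℝ} (hC0 : 0 ≤ C₀) (hC : ∀ ξ a b, ‖M ξ a b‖ ≤ C₀) (g : 𝓢(V, ι → ℂ)) :
    Integrable (fun ξ => (M ξ).mulVec (g ξ)) := by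
  have h := integrable_pow_mul_norm_mulVec hM hC0 hC g 0
  simp only [pow_zero, one_mul] at h
  exact (integrable_norm_iff
    (measurable_mulVec hM g.continuous.measurable).aestronglyMeasurable).1 h

/-- The guard of `IsLpMultiplierWith` / `HasGradientLpBoundWith` holds for bounded measurable
symbols: `M · 𝓕φ` is integrable for Schwartz `φ`. [folklore] -/
theorem integrable_mulVec_fourier {M : V → Matrix κ ι ℂ} (hM : ∀ a b, Measurable fun ξ => M ξ a b)
    {C₀ : ℝ} (hC0 : 0 ≤ C₀) (hC : ∀ ξ a b, ‖M ξ a b‖ ≤ C₀) (φ : 𝓢(V, ι → ℂ)) :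
    Integrable (fun ξ => (M ξ).mulVec (𝓕 (⇑φ) ξ)) := by
  rw [← SchwartzMap.fourier_coe]
  exact integrable_mulVec hM hC0 hC (𝓕 φ)

/-! ### Differentiation under the inverse Fourier integral -/

/-- **`∂ᵥ M(D)φ = M(D) ∂ᵥφ` for Schwartz `φ` and a bounded measurable symbol**: the multiplier
operator commutes with directional derivatives; in particular `M(D)φ` is differentiable.
[folklore] -/
theorem hasFDerivAt_multiplierOp {M : V → Matrix κ ι ℂ} (hM : ∀ a b, Measurable fun ξ => M ξ a b)
    {C₀ : ℝ} (hC0 : 0 ≤ C₀) (hC : ∀ ξ a b, ‖M ξ a b‖ ≤ C₀) (φ : 𝓢(V, ι → ℂ)) (x : V) :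
    ∃ L : V →L[ℝ] (κ → ℂ), HasFDerivAt (multiplierOp M ⇑φ) L x ∧
      ∀ v, L v = multiplierOp M (⇑(∂_{v} φ : 𝓢(V, ι → ℂ))) x := by
  -- the Fourier-side function and its reflection
  set h : V → κ → ℂ := fun ξ => (M ξ).mulVec (𝓕 (⇑φ) ξ) with hh
  set h' : V → κ → ℂ := fun ξ => h (-ξ) with hh'
  have hint : Integrable h := integrable_mulVec_fourier hM hC0 hC φ
  have hint1 : Integrable (fun ξ => ‖ξ‖ * ‖h ξ‖) := by
    have := integrable_pow_mul_norm_mulVec hM hC0 hC (𝓕 φ) 1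
    simpa [hh, SchwartzMap.fourier_coe, pow_one] using this
  have hint' : Integrable h' := hint.comp_neg
  have hint1' : Integrable (fun ξ => ‖ξ‖ * ‖h' ξ‖) := by
    have := hint1.comp_neg
    simpa [hh', norm_neg] using this
  have hop : multiplierOp M ⇑φ = 𝓕 h' := by
    rw [multiplierOp_apply, Real.fourierInv_eq_fourier_comp_neg]
  refine ⟨𝓕 (VectorFourier.fourierSMulRight (innerSL ℝ) h') x, ?_, fun v => ?_⟩
  · rw [hop]
    exact Real.hasFDerivAt_fourier hint' hint1' x
  · -- evaluate the derivative at `v`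
    have hintS : Integrable (VectorFourier.fourierSMulRight (innerSL ℝ) h') := by
      refine Integrable.mono' (hint1'.const_mul (2 * Real.pi * ‖innerSL ℝ (E := V)‖))
        hint'.1.fourierSMulRight (Filter.Eventually.of_forall fun ξ => ?_)
      calc ‖VectorFourier.fourierSMulRight (innerSL ℝ) h' ξ‖
          ≤ 2 * Real.pi * ‖innerSL ℝ (E := V)‖ * ‖ξ‖ * ‖h' ξ‖ :=
            VectorFourier.norm_fourierSMulRight_le _ _ _
        _ = 2 * Real.pi * ‖innerSL ℝ (E := V)‖ * (‖ξ‖ * ‖h' ξ‖) := by ring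
    rw [Real.fourier_continuousLinearMap_apply hintS]
    -- the right-hand side
    have hder : (fun ξ => (M ξ).mulVec (𝓕 (⇑(∂_{v} φ : 𝓢(V, ι → ℂ))) ξ))
        = fun ξ => (2 * Real.pi * Complex.I * (⟪ξ, v⟫ : ℝ)) • h ξ := by
      funext ξ
      have htg : (fun y : V => ⟪y, v⟫).HasTemperateGrowth := ((innerSL ℝ).flip v).hasTemperateGrowth
      have h1 : 𝓕 (⇑(∂_{v} φ : 𝓢(V, ι → ℂ))) ξ =
          (2 * Real.pi * Complex.I) • ((⟪ξ, v⟫ : ℝ) • 𝓕 (⇑φ) ξ) := by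
        rw [← SchwartzMap.fourier_coe, SchwartzMap.fourier_lineDerivOp_eq, smul_apply,
          SchwartzMap.smulLeftCLM_apply_apply htg, SchwartzMap.fourier_coe]
      rw [h1, Matrix.mulVec_smul, ← Complex.coe_smul, Matrix.mulVec_smul, smul_smul]
    rw [multiplierOp_apply, hder, Real.fourierInv_eq_fourier_comp_neg]
    have heq : (fun ξ => VectorFourier.fourierSMulRight (innerSL ℝ) h' ξ v)
        = fun ξ => (2 * Real.pi * Complex.I * (⟪-ξ, v⟫ : ℝ)) • h (-ξ) := by
      funext ξ
      rw [VectorFourier.fourierSMulRight_apply, innerSL_apply_apply, hh', inner_neg_left,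
        ← Complex.coe_smul, smul_smul]
      congr 1
      push_cast
      ring
    rw [heq]

/-- `M(D)φ` is differentiable (Schwartz `φ`, bounded measurable `M`). [folklore] -/
theorem differentiable_multiplierOp {M : V → Matrix κ ι ℂ} (hM : ∀ a b, Measurable fun ξ => M ξ a b)
    {C₀ : ℝ} (hC0 : 0 ≤ C₀) (hC : ∀ ξ a b, ‖M ξ a b‖ ≤ C₀) (φ : 𝓢(V, ι → ℂ)) :
    Differentiable ℝ (multiplierOp M ⇑φ) := fun x => by
  obtain ⟨L, hL, -⟩ := hasFDerivAt_multiplierOp hM hC0 hC φ x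
  exact hL.differentiableAt

/-- **`∂ᵥ(M(D)φ)(x) = M(D)(∂ᵥφ)(x)`** for Schwartz `φ` and a bounded measurable symbol `M`.
[folklore] -/
theorem fderiv_multiplierOp_apply {M : V → Matrix κ ι ℂ} (hM : ∀ a b, Measurable fun ξ => M ξ a b)
    {C₀ : ℝ} (hC0 : 0 ≤ C₀) (hC : ∀ ξ a b, ‖M ξ a b‖ ≤ C₀) (φ : 𝓢(V, ι → ℂ)) (x v : V) :
    fderiv ℝ (multiplierOp M ⇑φ) x v = multiplierOp M (fun y => fderiv ℝ (⇑φ) y v) x := by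
  obtain ⟨L, hL, hLv⟩ := hasFDerivAt_multiplierOp hM hC0 hC φ x
  rw [hL.fderiv, hLv v]
  rfl

/-- The same for a `C_c^∞` test function given as a plain function. [folklore] -/
theorem fderiv_multiplierOp_apply_of_contDiff {M : V → Matrix κ ι ℂ}
    (hM : ∀ a b, Measurable fun ξ => M ξ a b) {C₀ : ℝ} (hC0 : 0 ≤ C₀)
    (hC : ∀ ξ a b, ‖M ξ a b‖ ≤ C₀) {φ : V → ι → ℂ} (hφ : ContDiff ℝ ∞ φ)
    (hc : HasCompactSupport φ) (x v : V) :
    fderiv ℝ (multiplierOp M φ) x v = multiplierOp M (fun y => fderiv ℝ φ y v) x :=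
  fderiv_multiplierOp_apply hM hC0 hC (hc.toSchwartzMap hφ) x v

/-- `M(D)φ` is differentiable for a `C_c^∞` test function `φ`. [folklore] -/
theorem differentiable_multiplierOp_of_contDiff {M : V → Matrix κ ι ℂ}
    (hM : ∀ a b, Measurable fun ξ => M ξ a b) {C₀ : ℝ} (hC0 : 0 ≤ C₀)
    (hC : ∀ ξ a b, ‖M ξ a b‖ ≤ C₀) {φ : V → ι → ℂ} (hφ : ContDiff ℝ ∞ φ)
    (hc : HasCompactSupport φ) : Differentiable ℝ (multiplierOp M φ) :=
  differentiable_multiplierOp hM hC0 hC (hc.toSchwartzMap hφ)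

end Literature.Analysis.Fourier

end
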